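import Summits.ResolutionOfSingularities.ResolutionOfSingularities.Theorems.UniversalCellsPrimeFieldToPerfectOfFamilyResolutionInsep
import Summits.ResolutionOfSingularities.ResolutionOfSingularities.Theorems.UniformComplexityPrimeModelTransferOfFamilyResolutionOneFibre
import Summits.ResolutionOfSingularities.ResolutionOfSingularities.Theorems.UniformComplexityPrimeModelTransferSmoothFamilySpreadEmbedding
import Summits.ResolutionOfSingularities.ResolutionOfSingularities.Theorems.UniversalCellsCampaignW82FamilyResolutionInsepOneFibre
import HarnessLib

/-!
# Crux `PrimeFieldToPerfect` (stmt-ResolutionOfSingularities-15233), door 1 of slot W8.2: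
# ONE SMOOTH CLOSED FIBRE (a variety over a finite field when `k = 𝔽_p`), FLATLY, after a RADICIAL base
# extension — both directions

Route `ResolutionOfSingularities/UniversalCells`, crux `PrimeFieldToPerfect` (resolution over `Spec (ZMod p)`
⇒ resolution over every perfect field of characteristic `p`). Door-1 twin of the gen-6 door-2 files
p541728/p542421 for the OURS statements `CampaignW82.SmoothFamilyResolutionInsep`,
`CampaignW82.FamilyResolutionInsepOneFibre` (module `…CampaignW82FamilyResolutionInsepOneFibre.lean`):

* `smoothFamilyResolutionInsep_of_integralPerfectRes` — resolution over all perfect fields of characteristic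
  `p` ⇒ `SmoothFamilyResolutionInsep p k` for every `k` of characteristic `p` (strong spreading with
  embedding, `exists_smoothFamily_datum_embedding`; `A' ⊆ L = (Frac A)^{perf}` is radicial);
* `familyResolutionInsep_of_smoothFamilyResolutionInsep`, `familyResolutionInsepOneFibre_of_smooth…` —
  strong ⇒ gen-5 form (p533235) and ⇒ one-closed-fibre form;
* `hasResolution_of_familyResolutionInsepOneFibre` — **the E7 direction: `FamilyResolutionInsepOneFibre p k`
  ⇒ resolution over every PERFECT `K ⊇ k` of characteristic `p`**;
* `integralPerfectRes_of_familyResolutionInsepOneFibre` — at `k = ZMod p`: resolution of the integral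
  separated finite-type schemes over all perfect fields of characteristic `p`.

[OURS · LADDER-RESOLUTION L1, slot W8.2 (prime-field / universality transfer), door 1 UniversalCells]
Theorems over the summit's own route and OURS names; NOT statements of, and attributing nothing to,
Hironaka's 2017 manuscript (the OURS `Prop`s replace the role of §17 ¶2, p.89 l.59–62, see the definition
modules). AI-written; weaker than expert review. Barrier bookkeeping: the radicial `A → A'` is the inseparable
base change of the barrier files; no regular scheme is base-changed along it — smoothness of the `K`-fibre
comes from ONE smooth closed fibre + flatness + properness (EGA IV₃ 12.2.4 (iii)).

Sources: A. Grothendieck, J. Dieudonné, EGA IV₃ (1966) Thm. 12.2.4 (iii), Thm. 8.8.2 (ii); EGA IV₄ (1967)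
Thm. 17.5.1; The Stacks Project, Tags 01V8, 01ZM; Mathlib `PerfectRing.lift`.
[cite: EGAIV3, Thm. 12.2.4 (iii)] [cite: EGAIV4, Thm. 17.5.1] [cite: StacksProject, Tag 01V8]
-/

noncomputable section

set_option linter.dupNamespace false -- mandated namespace of this single-conjunct summit

open CategoryTheory CategoryTheory.Limits AlgebraicGeometry TopologicalSpace
open Literature.AlgebraicGeometry.Resolution

namespace Summit.ResolutionOfSingularities.ResolutionOfSingularities.Theorems.PrimeModelTransfer

open Literature.AlgebraicGeometry.Limits
open Literature.AlgebraicGeometry.Motives (SchemeOver specOver)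

set_option backward.isDefEq.respectTransparency false

/-! ## Resolution over perfect fields ⇒ the strong radicial family form -/

/-- **Resolution over all perfect fields of characteristic `p` ⇒ `SmoothFamilyResolutionInsep p k`** for
every field `k` of characteristic `p`: resolve the radicial generic fibre `𝒳 ×_A Spec L` over the perfect
`L` and spread with `exists_smoothFamily_datum_embedding`; the embedding `A' ↪ L` makes `A'` radicial over
`A` (as in gen 5's `familyResolutionInsep_of_integralPerfectRes`, p535806). [cite: EGAIV3, Thm. 8.10.5] -/
theorem smoothFamilyResolutionInsep_of_integralPerfectRes (p : ℕ) [Fact p.Prime]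
    (hperf : ∀ (K : Type) [Field K] [CharP K p] [PerfectField K] (X : Scheme.{0})
      (f : X ⟶ Spec (.of K)), IsSeparated f → LocallyOfFiniteType f → QuasiCompact f → IsIntegral X →
        Scheme.HasResolution X)
    (k : Type) [Field k] [CharP k p] : CampaignW82.SmoothFamilyResolutionInsep p k := by
  intro A _ _ _ hAft 𝒳 f hf hL
  obtain ⟨L, _, _, _, hAL, hrad, hint⟩ := hL
  haveI := hAft
  haveI := hf
  haveI : IsNoetherianRing A := Algebra.FiniteType.isNoetherianRing k A
  haveI : CharP A p := charP_of_injective_algebraMap (algebraMap k A).injective p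
  haveI : CharP L p := charP_of_injective_algebraMap hAL p
  haveI : Algebra.IsAlgebraic A L := by
    refine ⟨fun x => ?_⟩
    obtain ⟨n, a, b, hb, h⟩ := hrad x
    have hdeg : 0 < p ^ n := pow_pos (Fact.out : p.Prime).pos n
    refine ⟨Polynomial.C b * Polynomial.X ^ (p ^ n) - Polynomial.C a, ?_, by simp [h]⟩
    intro h0
    have h1 := congrArg Polynomial.natDegree h0
    rw [Polynomial.natDegree_sub_eq_left_of_natDegree_lt (by
        rw [Polynomial.natDegree_C, Polynomial.natDegree_C_mul_X_pow _ _ hb]; exact hdeg),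
      Polynomial.natDegree_C_mul_X_pow _ _ hb, Polynomial.natDegree_zero] at h1
    exact hdeg.ne' h1
  haveI := hint
  have hY : Scheme.HasResolution (pullback f (Spec.map (CommRingCat.ofHom (algebraMap A L)))) :=
    hperf L _ (pullback.snd f _) inferInstance inferInstance inferInstance hint
  obtain ⟨A', _, _, _, hinj, hft, -, ⟨e, he⟩, 𝒴, G, W, hG, hsm, hW, hsurj⟩ :=
    exists_smoothFamily_datum_embedding A L hAL 𝒳 f hint hY
  refine ⟨A', inferInstance, inferInstance, inferInstance, hinj, hft, fun x => ?_, 𝒴, G, W, hG, hsm, hW, hsurj⟩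
  obtain ⟨n, a, b, hb, h⟩ := hrad (e x)
  refine ⟨n, a, b, hb, he ?_⟩
  rw [map_mul, map_pow, e.commutes, e.commutes]
  exact h

/-! ## The strong form implies the other two -/

/-- **`SmoothFamilyResolutionInsep p k → FamilyResolutionInsep p k`** (gen 5's form, p533235): the
field-valued fibres of the smooth modified family are weak resolutions
(`isWeakResolution_pullback_of_smooth`, p542421). [folklore] -/
theorem familyResolutionInsep_of_smoothFamilyResolutionInsep (p : ℕ) (k : Type) [Field k]
    (h : CampaignW82.SmoothFamilyResolutionInsep p k) : CampaignW82.FamilyResolutionInsep p k := by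
  intro A _ _ _ hAft 𝒳 f hf hL
  obtain ⟨A', _, _, _, hinj, hft, hrad, 𝒴, G, W, hGp, hsm, hWiso, hW⟩ := h A hAft 𝒳 f hf hL
  refine ⟨A', inferInstance, inferInstance, inferInstance, hinj, hft, hrad, 𝒴, G, fun Ω _ φ => ?_⟩
  haveI := hGp; haveI := hsm; haveI := hWiso; haveI := hf
  haveI : Nonempty ↥(Spec (CommRingCat.of Ω)) := inferInstanceAs (Nonempty (PrimeSpectrum Ω))
  let pt : ↥(Spec (CommRingCat.of Ω)) := Nonempty.some inferInstance
  obtain ⟨x, hxW, hx⟩ := hW ((Spec.map (CommRingCat.ofHom φ)) pt)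
  exact isWeakResolution_pullback_of_smooth _ G W Ω (Spec.map (CommRingCat.ofHom φ))
    ⟨x, hxW, ⟨pt, hx.symm⟩⟩

/-- **`SmoothFamilyResolutionInsep p k → FamilyResolutionInsepOneFibre p k`**: take any closed point of
`Spec A'`; smooth ⇒ flat; the fibre of a smooth morphism is smooth. [folklore] -/
theorem familyResolutionInsepOneFibre_of_smoothFamilyResolutionInsep (p : ℕ) (k : Type) [Field k]
    (h : CampaignW82.SmoothFamilyResolutionInsep p k) : CampaignW82.FamilyResolutionInsepOneFibre p k := by
  intro A _ _ _ hAft 𝒳 f hf hL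
  obtain ⟨A', _, _, _, hinj, hft, hrad, 𝒴, G, W, hGp, hsm, hWiso, hW⟩ := h A hAft 𝒳 f hf hL
  haveI := hsm
  obtain ⟨𝔪, h𝔪⟩ := Ideal.exists_maximal A'
  let s : ↥(Spec (CommRingCat.of A')) := (⟨𝔪, h𝔪.isPrime⟩ : PrimeSpectrum A')
  have hs : IsClosed ({s} : Set ↥(Spec (CommRingCat.of A'))) :=
    (PrimeSpectrum.isClosed_singleton_iff_isMaximal _).mpr h𝔪
  refine ⟨A', inferInstance, inferInstance, inferInstance, hinj, hft, hrad, 𝒴, G, W, s, hs, hGp, hWiso,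
    hW s, fun y _ => Flat.stalkMap _ y, ?_⟩
  change Smooth (pullback.snd _ _)
  infer_instance

/-! ## ONE SMOOTH CLOSED FIBRE ⇒ resolution over every PERFECT `K ⊇ k` -/

/-- **One-closed-fibre radicial resolution in families over `k` implies resolution over every PERFECT
`K ⊇ k` of characteristic `p`.** Let `k ⊆ K` be fields with `K` perfect of characteristic `p` and assume
`CampaignW82.FamilyResolutionInsepOneFibre p k`. Then every integral separated `K`-scheme of finite type has
a resolution. Proof (door-1 twin of `hasResolution_of_familyResolutionOneFibre`, p542421): Nagata + Chow;
`Y = X' ×_R Spec K` for a proper family over a finitely generated `k`-subalgebra `ψ : R ⊆ K`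
(`exists_isPullback_proper_subalgebra`, p528212); the RADICIAL generic fibre over `L := perfectClosure (Frac R) K`
is integral (`exists_perfectClosure_inside`, p535424; `Y` is its flat surjective base change); the hypothesis
gives `R → A'` radicial finite-type injective, `G`, `W`, a closed `s`, flatness of `q : 𝒴 → Spec A'` over
`s` and a smooth fibre `q⁻¹(s)`; EGA IV₃ 12.2.4 (iii) (`Morphisms.exists_smooth_morphismRestrict_of_smooth_fiber`)
makes `q` smooth over an open `V ∋ s`; the `K`-point LIFTS along the radicial `A'` because `K` is perfect
(`exists_ringHom_comp_eq_of_radicial`, p535424 — `PerfectRing.lift`), INJECTIVELY (`A'` is a domain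
algebraic over `R ⊆ K`, `Ideal.comap_ne_bot_of_algebraic_mem`), hence to the generic point `∈ V`; the
`K`-fibre of `G` is proper with source smooth over `K` (`smooth_of_isPullback_of_range_subset`), hence
regular, and an isomorphism over the preimage of `W`, non-empty by `Flat.generalizingMap`;
`hasResolution_of_isIso_morphismRestrict` (p483756). [cite: EGAIV3, Thm. 12.2.4 (iii)]
[cite: StacksProject, Tag 01ZM] -/
theorem hasResolution_of_familyResolutionInsepOneFibre (p : ℕ) [Fact p.Prime] (k K : Type) [Field k]
    [Field K] [CharP K p] [PerfectField K] [Algebra k K]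
    (hOF : CampaignW82.FamilyResolutionInsepOneFibre p k)
    (X : Scheme.{0}) (f : X ⟶ Spec (.of K)) [IsSeparated f] [LocallyOfFiniteType f]
    [QuasiCompact f] [IsIntegral X] : Scheme.HasResolution X := by
  classical
  -- ### Step 0: it suffices to resolve integral PROJECTIVE `K`-schemes (Nagata + Chow)
  refine hasResolution_of_forall_proper K (fun Y₀ g₀ hg₀ hY₀ => ?_) X f
  haveI := hg₀
  haveI := hY₀
  obtain ⟨n, Y, ρ, ι, hY, hι, hρ, -, hw, U, hUd, hUpre, hUiso⟩ :=
    ChowLemmaRing.chow_proper (R := K) Y₀ g₀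
  haveI := hρ
  haveI := hι
  haveI := hY
  let g : Y ⟶ Spec (.of K) := ρ ≫ g₀
  have hproj : ChowLemmaRing.IsProjOver (Over.mk g : SchemeOver K) := ⟨n, Over.homMk ι hw, hι⟩
  refine Scheme.HasResolution.of_isBirational ρ ⟨U, hUd, hUpre, hUiso⟩ ?_
  -- ### Step 1: a proper model `F : X' → Spec R` over a finitely generated `k`-subalgebra `R ⊆ K`
  obtain ⟨R, _, _, _, ψ, X', F, π, hψ, hRft, hF, hsq⟩ :=
    exists_isPullback_proper_subalgebra k K g hproj
  haveI := hRft
  haveI := hF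
  letI : Algebra R K := ψ.toAlgebra
  haveI : FaithfulSMul R K := (faithfulSMul_iff_algebraMap_injective R K).mpr hψ
  -- ### Step 2: the radicial generic fibre `X' ×_R Spec L`, `L` = a perfect closure of `Frac R` inside
  -- `K`, is integral (`Y` is its flat surjective base change)
  obtain ⟨L, _, _, _, σ, hRLinj, hσ, hrad⟩ := exists_perfectClosure_inside p ψ hψ
  let iL : Spec (.of L) ⟶ Spec (.of R) := Spec.map (CommRingCat.ofHom (algebraMap R L))
  let jσ : Spec (.of K) ⟶ Spec (.of L) := Spec.map (CommRingCat.ofHom σ)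
  have hjσ : jσ ≫ iL = Spec.map (CommRingCat.ofHom ψ) := by
    change Spec.map _ ≫ Spec.map _ = _
    rw [← Spec.map_comp, ← CommRingCat.ofHom_comp, hσ]
  let XL : Scheme.{0} := pullback F iL
  let FL : XL ⟶ Spec (.of L) := pullback.snd F iL
  let m : Y ⟶ XL := pullback.lift π (g ≫ jσ) (by rw [Category.assoc, hjσ]; exact hsq.w)
  have hsqm : IsPullback m g FL jσ := by
    have outer : IsPullback (m ≫ pullback.fst F iL) g F (jσ ≫ iL) := by
      rw [pullback.lift_fst, hjσ]; exact hsq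
    exact outer.of_right (pullback.lift_snd _ _ _) (IsPullback.of_hasPullback F iL)
  haveI : Subsingleton ↥(Spec (CommRingCat.of L)) := inferInstanceAs (Subsingleton (PrimeSpectrum L))
  haveI : Subsingleton ↥(Spec (CommRingCat.of K)) := inferInstanceAs (Subsingleton (PrimeSpectrum K))
  haveI : Nonempty ↥(Spec (CommRingCat.of K)) := inferInstanceAs (Nonempty (PrimeSpectrum K))
  haveI : Flat jσ := by
    letI : Algebra L K := σ.toAlgebra
    haveI hflat : Module.Flat L K := inferInstance
    rw [show jσ = Spec.map (CommRingCat.ofHom (algebraMap L K)) from rfl, Flat.SpecMap_iff,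
      CommRingCat.hom_ofHom]
    exact RingHom.flat_algebraMap_iff.mpr hflat
  haveI : Surjective jσ := inferInstance
  haveI : Flat m := MorphismProperty.of_isPullback (P := @Flat) hsqm.flip ‹Flat jσ›
  haveI : Surjective m := MorphismProperty.of_isPullback (P := @Surjective) hsqm.flip ‹Surjective jσ›
  haveI : IsReduced XL := Literature.AlgebraicGeometry.Morphisms.isReduced_of_flat_of_surjective m
  haveI : IrreducibleSpace XL := Function.Surjective.irreducibleSpace m.continuous m.surjective
  have hint : IsIntegral XL := isIntegral_of_irreducibleSpace_of_isReduced XL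
  -- ### Step 3: the one-closed-fibre datum over an algebraic finite-type extension `A'`
  obtain ⟨A', _, _, _, hinj, hA'ft, hradA, 𝒴, G, W, s, -, hGp, hWiso, ⟨x, hxW, hxs⟩, hflat, hsm⟩ :=
    hOF.exists_datum R X' F L hRLinj hrad hint
  haveI : Algebra.IsAlgebraic R A' := by
    refine ⟨fun a => ?_⟩
    obtain ⟨n, c, d, hd, h⟩ := hradA a
    have hdeg : 0 < p ^ n := pow_pos (Fact.out : p.Prime).pos n
    refine ⟨Polynomial.C d * Polynomial.X ^ (p ^ n) - Polynomial.C c, ?_, by simp [h]⟩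
    intro h0
    have h1 := congrArg Polynomial.natDegree h0
    rw [Polynomial.natDegree_sub_eq_left_of_natDegree_lt (by
        rw [Polynomial.natDegree_C, Polynomial.natDegree_C_mul_X_pow _ _ hd]; exact hdeg),
      Polynomial.natDegree_C_mul_X_pow _ _ hd, Polynomial.natDegree_zero] at h1
    exact hdeg.ne' h1
  haveI := hGp
  haveI := hWiso
  haveI := hA'ft
  haveI : IsNoetherianRing R := Algebra.FiniteType.isNoetherianRing k R
  haveI : IsNoetherianRing A' := Algebra.FiniteType.isNoetherianRing R A'
  let ιA : Spec (.of A') ⟶ Spec (.of R) := Spec.map (CommRingCat.ofHom (algebraMap R A'))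
  let F' : pullback F ιA ⟶ Spec (.of A') := pullback.snd F ιA
  let q : 𝒴 ⟶ Spec (.of A') := G ≫ F'
  haveI : IsProper F' := inferInstance
  haveI : IsSeparated F' := inferInstance
  haveI : IsProper q := inferInstance
  haveI : LocallyOfFinitePresentation q := by
    rw [HasRingHomProperty.iff_appLE (P := @LocallyOfFinitePresentation)]
    intro U V e
    haveI := IsLocallyNoetherian.component_noetherian (X := Spec (.of A')) U
    exact RingHom.FinitePresentation.of_finiteType.mp
      (HasRingHomProperty.appLE @LocallyOfFiniteType q inferInstance U V e)
  -- ### Step 4 (EGA IV₃ 12.2.4 (iii)): `q` is smooth over an open `V ∋ s`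
  obtain ⟨V, hsV, hVsm⟩ :=
    Literature.AlgebraicGeometry.Morphisms.exists_smooth_morphismRestrict_of_smooth_fiber q hflat hsm
  haveI := hVsm
  -- ### Step 5: the `K`-point `R ⊆ K` lifts along the RADICIAL `A'` (`K` perfect) to an INJECTIVE
  -- `τ : A' → K`, i.e. to the generic point
  haveI : CharP R p := ψ.charP hψ p
  obtain ⟨τ, hτ⟩ := exists_ringHom_comp_eq_of_radicial p hinj hradA K ψ hψ
  have hτinj : Function.Injective τ := by
    rw [injective_iff_map_eq_zero]
    intro a ha
    by_contra ha0
    have h1 : (RingHom.ker τ).comap (algebraMap R A') ≠ ⊥ :=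
      Ideal.comap_ne_bot_of_algebraic_mem ha0 ((RingHom.mem_ker).mpr ha)
        (Algebra.IsAlgebraic.isAlgebraic a)
    apply h1
    rw [eq_bot_iff]
    intro r hr
    rw [Ideal.mem_comap, RingHom.mem_ker, ← RingHom.comp_apply, hτ] at hr
    exact (Ideal.mem_bot).mpr ((injective_iff_map_eq_zero ψ).mp hψ r hr)
  let cτ : Spec (.of K) ⟶ Spec (.of A') := Spec.map (CommRingCat.ofHom τ)
  have hcτ : cτ ≫ ιA = Spec.map (CommRingCat.ofHom ψ) := by
    change Spec.map _ ≫ Spec.map _ = _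
    rw [← Spec.map_comp, ← CommRingCat.ofHom_comp, hτ]
  -- the image of `Spec K` is the generic point: it generizes every point of `Spec A'`
  have hgen : ∀ (t : ↥(Spec (CommRingCat.of K))) (z : ↥(Spec (CommRingCat.of A'))), cτ t ⤳ z := by
    intro t z
    have hbot : (cτ t).asIdeal = ⊥ := by
      change Ideal.comap τ t.asIdeal = ⊥
      rw [Ideal.eq_bot_of_prime t.asIdeal]
      exact Ideal.comap_bot_of_injective _ hτinj
    exact (PrimeSpectrum.le_iff_specializes _ _).mp
      ((PrimeSpectrum.asIdeal_le_asIdeal _ _).mp (by rw [hbot]; exact bot_le))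
  have hcτV : Set.range cτ ⊆ (V : Set ↥(Spec (CommRingCat.of A'))) := by
    rintro _ ⟨t, rfl⟩
    exact (hgen t s).mem_open V.2 hsV
  -- ### Step 6: the `K`-fibre `G_K : 𝒴_K → (X' ×_R A') ×_{A'} K ≅ Y` is a weak resolution
  let Xτ : Scheme.{0} := pullback F' cτ
  let gτ : Xτ ⟶ pullback F ιA := pullback.fst F' cτ
  let pτ : Xτ ⟶ Spec (.of K) := pullback.snd F' cτ
  let Gτ : pullback G gτ ⟶ Xτ := pullback.snd G gτ
  have HG : IsPullback (pullback.fst G gτ) Gτ G gτ := IsPullback.of_hasPullback G gτ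
  have Hc : IsPullback gτ pτ F' cτ := IsPullback.of_hasPullback F' cτ
  have Hq : IsPullback (pullback.fst G gτ) (Gτ ≫ pτ) q cτ := HG.paste_vert Hc
  haveI : Smooth (Gτ ≫ pτ) := smooth_of_isPullback_of_range_subset V Hq hcτV
  haveI : IsProper (Gτ ≫ pτ) := MorphismProperty.of_isPullback (P := @IsProper) Hq inferInstance
  haveI : IsSeparated pτ := inferInstance
  haveI : IsProper Gτ := IsProper.of_comp Gτ pτ
  have hreg : Scheme.IsRegular (pullback G gτ) := fun y =>
    isRegularLocalRing_stalk_of_smooth_of_field (Gτ ≫ pτ) y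
  haveI : IsIso (Gτ ∣_ (gτ ⁻¹ᵁ W)) :=
    Literature.AlgebraicGeometry.Morphisms.isIso_morphismRestrict_pullback_snd G gτ W
  -- a point of `G⁻¹(W)` over `s` …
  let y₀' : ↥(G ⁻¹ᵁ W) := inv (G ∣_ W) ⟨x, hxW⟩
  let y₀ : ↥𝒴 := (G ⁻¹ᵁ W).ι y₀'
  have hy₀W : y₀ ∈ G ⁻¹ᵁ W := by
    change (G ⁻¹ᵁ W).ι y₀' ∈ G ⁻¹ᵁ W
    rw [show ((G ⁻¹ᵁ W).ι y₀' : ↥𝒴) = (y₀' : ↥𝒴) from rfl]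
    exact y₀'.2
  have hGy₀ : G y₀ = x := by
    change ((G ⁻¹ᵁ W).ι ≫ G) y₀' = x
    rw [← morphismRestrict_ι, Scheme.Hom.comp_apply]
    change ((W.ι) ((inv (G ∣_ W) ≫ (G ∣_ W)) ⟨x, hxW⟩)) = x
    rw [IsIso.inv_hom_id]
    rfl
  have hqy₀ : q y₀ = s := by
    change F' (G y₀) = s
    rw [hGy₀]; exact hxs
  -- … generizes, along the flat `q|_V`, to a point of `G⁻¹(W)` over the generic point
  haveI : Nonempty ↥(Spec (CommRingCat.of K)) := inferInstanceAs (Nonempty (PrimeSpectrum K))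
  let pt : ↥(Spec (CommRingCat.of K)) := Nonempty.some inferInstance
  have hy₀V : y₀ ∈ q ⁻¹ᵁ V := by
    change q y₀ ∈ V
    rw [hqy₀]; exact hsV
  let a : ↥(q ⁻¹ᵁ V) := ⟨y₀, hy₀V⟩
  let b : ↥V := ⟨cτ pt, hcτV ⟨pt, rfl⟩⟩
  have hab : b ⤳ (q ∣_ V) a := by
    rw [← (V.ι).isOpenEmbedding.isEmbedding.isInducing.specializes_iff]
    have h1 : (V.ι) ((q ∣_ V) a) = q y₀ := by
      rw [← Scheme.Hom.comp_apply, morphismRestrict_ι, Scheme.Hom.comp_apply]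
      rfl
    rw [h1, hqy₀]
    exact hgen pt s
  obtain ⟨a', ha'a, ha'b⟩ := Flat.generalizingMap (q ∣_ V) hab
  let y₁ : ↥𝒴 := (q ⁻¹ᵁ V).ι a'
  have hy₁y₀ : y₁ ⤳ y₀ := ha'a.map (q ⁻¹ᵁ V).ι.continuous
  have hy₁W : y₁ ∈ G ⁻¹ᵁ W := hy₁y₀.mem_open (G ⁻¹ᵁ W).2 hy₀W
  have hqy₁ : q y₁ = cτ pt := by
    change ((q ⁻¹ᵁ V).ι ≫ q) a' = cτ pt
    rw [← morphismRestrict_ι, Scheme.Hom.comp_apply, ha'b]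
    rfl
  -- hence the preimage of `W` in the `K`-fibre is non-empty
  have hw : F' (G y₁) = cτ pt := by rw [← Scheme.Hom.comp_apply]; exact hqy₁
  obtain ⟨z, hz, -⟩ := Scheme.Pullback.exists_preimage_pullback (f := F') (g := cτ) (G y₁) pt hw
  have hne : ((gτ ⁻¹ᵁ W : Xτ.Opens) : Set ↥Xτ).Nonempty :=
    ⟨z, show gτ z ∈ W by rw [show gτ z = G y₁ from hz]; exact hy₁W⟩
  -- ### Step 7: conclude on `(X' ×_R A') ×_{A'} K ≅ Y`
  let e : Xτ ≅ Y :=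
    pullbackLeftPullbackSndIso F ιA cτ ≪≫ pullback.congrHom rfl hcτ ≪≫ hsq.isoPullback.symm
  haveI : IrreducibleSpace ↥Xτ :=
    Function.Surjective.irreducibleSpace e.inv.continuous e.inv.surjective
  haveI : IsProper pτ := inferInstance
  haveI : IsNoetherian (pullback G gτ) := isNoetherian_of_locallyOfFiniteType (Gτ ≫ pτ)
  exact Scheme.HasResolution.of_iso e.hom
    (hasResolution_of_isIso_morphismRestrict Gτ hreg (gτ ⁻¹ᵁ W) hne)


/-! ## At the prime field -/

/-- **`FamilyResolutionInsepOneFibre p (ZMod p)` ⇒ resolution of the integral separated finite-type schemes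
over every PERFECT field of characteristic `p`** (`ZMod p` embeds into every field of characteristic `p`).
[folklore] -/
theorem integralPerfectRes_of_familyResolutionInsepOneFibre (p : ℕ) [Fact p.Prime]
    (h : CampaignW82.FamilyResolutionInsepOneFibre p (ZMod p)) :
    ∀ (K : Type) [Field K] [CharP K p] [PerfectField K] (X : Scheme.{0}) (f : X ⟶ Spec (.of K)),
      IsSeparated f → LocallyOfFiniteType f → QuasiCompact f → IsIntegral X → Scheme.HasResolution X := by
  intro K _ _ _ X f hs hl hq hX
  haveI := hs; haveI := hl; haveI := hq; haveI := hX
  letI : Algebra (ZMod p) K := ZMod.algebra K p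
  exact hasResolution_of_familyResolutionInsepOneFibre p (ZMod p) K h X f

end Summit.ResolutionOfSingularities.ResolutionOfSingularities.Theorems.PrimeModelTransfer

end
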